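import Mathlib.Analysis.Calculus.BumpFunction.SmoothApprox
import Mathlib.Analysis.Convex.Deriv
import Mathlib.Analysis.Calculus.Deriv.Slope
import Mathlib.Analysis.Calculus.Deriv.Mul
import HarnessLib

/-!
# FunctionalMining — mollified convex Lipschitz weights; the sign of the second derivative

Search for candidate a priori estimates; no regularity claim. Cell `pub-nsfunc`, prove seat
(gen 16). Two pieces of finite-dimensional calculus used to run a balance law with the NON-SMOOTH
convex weight `S ↦ λ₁(S)` (top strain eigenvalue; K0 rows `ES.lam1.q|T_C|C1`,
`ES.neglam3.q|T_C|C1`):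

* `ConvexMollifier.mollify μ φ g = φ̃ ⋆ g` — convolution with a normed bump `φ̃` (Mathlib
  `ContDiffBump.normed`): for a continuous `g` it is `C^∞` (`contDiff_mollify`, Mathlib
  `HasCompactSupport.contDiff_convolution_left`); for an `L`-Lipschitz `g` it is `L`-Lipschitz,
  within `L·r_out` of `g` (`abs_mollify_sub_le`, Mathlib `ContDiffBump.dist_normed_convolution_le`)
  and has `‖D(φ̃ ⋆ g)‖ ≤ L`; for a convex `g` it is CONVEX (`convexOn_mollify`: an average of
  translates of a convex function).
* `ConvexMollifier.hessian_quadratic_nonneg` — if `t ↦ F(z + t w)` is convex near `t = 0` and `F` is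
  `C²` there, then `D²F(z)[w, w] ≥ 0` (the derivative of a convex differentiable function is
  monotone, Mathlib `ConvexOn.monotoneOn_deriv`; a monotone function has a non-negative derivative).

[ours; folklore real analysis]
-/

noncomputable section

open MeasureTheory Set Filter Topology Metric
open scoped ContDiff NNReal Convolution

namespace Summit.NavierStokesRegularity.FunctionalMining

namespace ConvexMollifier

section Mollify

variable {E : Type*} [NormedAddCommGroup E] [InnerProductSpace ℝ E] [FiniteDimensional ℝ E]
  [MeasurableSpace E] [BorelSpace E] (μ : Measure E) [μ.IsAddHaarMeasure]

/-- The mollification `φ̃ ⋆ g` of `g : E → ℝ` by the normed bump `φ̃ = φ.normed μ`. [folklore] -/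
def mollify (φ : ContDiffBump (0 : E)) (g : E → ℝ) : E → ℝ :=
  φ.normed μ ⋆[ContinuousLinearMap.lsmul ℝ ℝ, μ] g

omit [BorelSpace E] [μ.IsAddHaarMeasure] in
/-- `(φ̃ ⋆ g)(x) = ∫ φ̃(t) g(x − t) dt`. [folklore] -/
theorem mollify_apply (φ : ContDiffBump (0 : E)) (g : E → ℝ) (x : E) :
    mollify μ φ g x = ∫ t, φ.normed μ t * g (x - t) ∂μ := by
  rw [mollify, convolution_lsmul]
  rfl

/-- The mollification of a continuous function is smooth. [folklore] -/
theorem contDiff_mollify (φ : ContDiffBump (0 : E)) {g : E → ℝ} (hg : Continuous g) :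
    ContDiff ℝ ∞ (mollify μ φ g) :=
  φ.hasCompactSupport_normed.contDiff_convolution_left _ φ.contDiff_normed (hg.locallyIntegrable)

/-- The mollification of an `L`-Lipschitz function is within `L · r_out` of it. [folklore] -/
theorem abs_mollify_sub_le (φ : ContDiffBump (0 : E)) {g : E → ℝ} {L : ℝ≥0}
    (hg : LipschitzWith L g) (x : E) : |mollify μ φ g x - g x| ≤ L * φ.rOut := by
  have h := φ.dist_normed_convolution_le (μ := μ) (x₀ := x) (ε := L * φ.rOut)
    hg.continuous.aestronglyMeasurable (fun y hy => by
      calc dist (g y) (g x) ≤ L * dist y x := hg.dist_le_mul y x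
        _ ≤ L * φ.rOut := mul_le_mul_of_nonneg_left (le_of_lt (mem_ball.1 hy)) L.coe_nonneg)
  rwa [Real.dist_eq] at h

/-- The integrand `t ↦ φ̃(t) g(x − t)` is integrable for continuous `g`. [folklore] -/
theorem integrable_normed_mul (φ : ContDiffBump (0 : E)) {g : E → ℝ} (hg : Continuous g) (x : E) :
    Integrable (fun t => φ.normed μ t * g (x - t)) μ :=
  (φ.continuous_normed.mul (hg.comp (continuous_const.sub continuous_id))).integrable_of_hasCompactSupport
    φ.hasCompactSupport_normed.mul_right

/-- **Mollification preserves convexity** (an average of the convex translates `g(· − t)`).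
[folklore] -/
theorem convexOn_mollify (φ : ContDiffBump (0 : E)) {g : E → ℝ} (hg : ConvexOn ℝ univ g)
    (hgc : Continuous g) : ConvexOn ℝ univ (mollify μ φ g) := by
  refine ⟨convex_univ, fun x _ y _ a b ha hb hab => ?_⟩
  simp only [smul_eq_mul, mollify_apply]
  have hpt : ∀ t, φ.normed μ t * g (a • x + b • y - t) ≤
      a * (φ.normed μ t * g (x - t)) + b * (φ.normed μ t * g (y - t)) := by
    intro t
    have hconv := hg.2 (mem_univ (x - t)) (mem_univ (y - t)) ha hb hab
    have e : a • (x - t) + b • (y - t) = a • x + b • y - t := by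
      calc a • (x - t) + b • (y - t) = a • x + b • y - (a + b) • t := by
            rw [smul_sub, smul_sub, add_smul]; abel
        _ = a • x + b • y - t := by rw [hab, one_smul]
    rw [e] at hconv
    simp only [smul_eq_mul] at hconv
    have hφ := φ.nonneg_normed (μ := μ) t
    nlinarith
  have hi1 := integrable_normed_mul μ φ hgc x
  have hi2 := integrable_normed_mul μ φ hgc y
  have hi := integrable_normed_mul μ φ hgc (a • x + b • y)
  calc ∫ t, φ.normed μ t * g (a • x + b • y - t) ∂μ
      ≤ ∫ t, (a * (φ.normed μ t * g (x - t)) + b * (φ.normed μ t * g (y - t))) ∂μ :=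
        integral_mono hi ((hi1.const_mul a).add (hi2.const_mul b)) hpt
    _ = a * ∫ t, φ.normed μ t * g (x - t) ∂μ + b * ∫ t, φ.normed μ t * g (y - t) ∂μ := by
        rw [integral_add (hi1.const_mul a) (hi2.const_mul b), integral_const_mul, integral_const_mul]

/-- **Mollification preserves the Lipschitz constant.** [folklore] -/
theorem lipschitzWith_mollify (φ : ContDiffBump (0 : E)) {g : E → ℝ} {L : ℝ≥0}
    (hg : LipschitzWith L g) : LipschitzWith L (mollify μ φ g) := by
  have hgc : Continuous g := hg.continuous
  refine LipschitzWith.of_dist_le_mul fun x y => ?_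
  rw [Real.dist_eq, mollify_apply, mollify_apply,
    ← integral_sub (integrable_normed_mul μ φ hgc x) (integrable_normed_mul μ φ hgc y)]
  have hpt : ∀ t, |φ.normed μ t * g (x - t) - φ.normed μ t * g (y - t)| ≤
      φ.normed μ t * (L * dist x y) := by
    intro t
    rw [← mul_sub, abs_mul, abs_of_nonneg (φ.nonneg_normed t)]
    refine mul_le_mul_of_nonneg_left ?_ (φ.nonneg_normed t)
    have h := hg.dist_le_mul (x - t) (y - t)
    rw [Real.dist_eq, dist_eq_norm, show x - t - (y - t) = x - y by abel, ← dist_eq_norm] at h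
    exact h
  calc |∫ t, (φ.normed μ t * g (x - t) - φ.normed μ t * g (y - t)) ∂μ|
      ≤ ∫ t, |φ.normed μ t * g (x - t) - φ.normed μ t * g (y - t)| ∂μ := abs_integral_le_integral_abs
    _ ≤ ∫ t, φ.normed μ t * (L * dist x y) ∂μ :=
        integral_mono_of_nonneg (ae_of_all _ fun t => abs_nonneg _)
          (φ.integrable_normed.mul_const _) (ae_of_all _ hpt)
    _ = L * dist x y := by rw [integral_mul_const, φ.integral_normed, one_mul]

/-- The derivative of the mollification of an `L`-Lipschitz function has norm `≤ L`. [folklore] -/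
theorem norm_fderiv_mollify_le (φ : ContDiffBump (0 : E)) {g : E → ℝ} {L : ℝ≥0}
    (hg : LipschitzWith L g) (x : E) : ‖fderiv ℝ (mollify μ φ g) x‖ ≤ L :=
  norm_fderiv_le_of_lipschitz ℝ (lipschitzWith_mollify μ φ hg)

/-- Two-sided sandwich: `g − L r_out ≤ φ̃ ⋆ g ≤ g + L r_out`. [folklore] -/
theorem mollify_mem_Icc (φ : ContDiffBump (0 : E)) {g : E → ℝ} {L : ℝ≥0}
    (hg : LipschitzWith L g) (x : E) :
    g x - L * φ.rOut ≤ mollify μ φ g x ∧ mollify μ φ g x ≤ g x + L * φ.rOut := by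
  have h := abs_mollify_sub_le μ φ hg x
  rw [abs_le] at h
  constructor <;> linarith [h.1, h.2]

end Mollify

/-! ## The second derivative of a locally convex `C²` function along a line is non-negative -/

section Hessian

variable {E : Type*} [NormedAddCommGroup E] [NormedSpace ℝ E]

/-- **`D²F(z)[w,w] ≥ 0`** when `t ↦ F(z + t w)` is convex on a neighbourhood `(−r, r)` of `0` and
`F` is `C²` at the points `z + t w`, `|t| < r`. [folklore] -/
theorem hessian_quadratic_nonneg {F : E → ℝ} {z w : E} {r : ℝ} (hr : 0 < r)
    (hconv : ConvexOn ℝ (Ioo (-r) r) (fun t : ℝ => F (z + t • w)))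
    (hF : ∀ t ∈ Ioo (-r) r, ContDiffAt ℝ 2 F (z + t • w)) :
    0 ≤ (fderiv ℝ (fderiv ℝ F) z w) w := by
  set ψ : ℝ → ℝ := fun t => F (z + t • w) with hψ
  set ψ₁ : ℝ → ℝ := fun t => fderiv ℝ F (z + t • w) w with hψ₁
  have hline : ∀ t : ℝ, HasDerivAt (fun s : ℝ => z + s • w) w t := fun t => by
    have h := ((hasDerivAt_id t).smul_const w).const_add z
    simpa using h
  have hψd : ∀ t ∈ Ioo (-r) r, HasDerivAt ψ (ψ₁ t) t := fun t ht =>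
    (((hF t ht).differentiableAt (by norm_num)).hasFDerivAt.comp_hasDerivAt t (hline t))
  have hmono : MonotoneOn (deriv ψ) (Ioo (-r) r) :=
    hconv.monotoneOn_deriv fun t ht => (hψd t ht).differentiableAt
  have hmono' : MonotoneOn ψ₁ (Ioo (-r) r) :=
    hmono.congr fun t ht => (hψd t ht).deriv
  -- the derivative of `ψ₁` at `0`
  have h0 : (0 : ℝ) ∈ Ioo (-r) r := ⟨by linarith, hr⟩
  have hF0 : ContDiffAt ℝ 2 F z := by simpa using hF 0 h0
  have hc : HasFDerivAt (fderiv ℝ F) (fderiv ℝ (fderiv ℝ F) z) z :=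
    ((hF0.fderiv_right (m := 1) le_rfl).differentiableAt (by simp)).hasFDerivAt
  have hc' : HasDerivAt (fun t : ℝ => fderiv ℝ F (z + t • w)) (fderiv ℝ (fderiv ℝ F) z w) 0 := by
    have h := hline 0
    have hz : z + (0 : ℝ) • w = z := by simp
    have hc0 : HasFDerivAt (fderiv ℝ F) (fderiv ℝ (fderiv ℝ F) z) (z + (0 : ℝ) • w) := by
      rw [hz]; exact hc
    exact hc0.comp_hasDerivAt (0 : ℝ) h
  have hψ₁d : HasDerivAt ψ₁ ((fderiv ℝ (fderiv ℝ F) z w) w) 0 := by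
    have h := hc'.clm_apply (hasDerivAt_const (0 : ℝ) w)
    simpa using h
  -- monotone on a neighbourhood of `0` ⇒ non-negative derivative
  have hlim := hψ₁d.tendsto_slope_zero_right
  refine ge_of_tendsto hlim ?_
  filter_upwards [Ioo_mem_nhdsGT hr] with t ht
  have hmem : t ∈ Ioo (-r) r := ⟨by linarith [ht.1], ht.2⟩
  have hle : ψ₁ 0 ≤ ψ₁ (0 + t) := by
    rw [zero_add]; exact hmono' h0 hmem ht.1.le
  exact smul_nonneg (inv_nonneg.2 ht.1.le) (by linarith)

end Hessian

end ConvexMollifier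

end Summit.NavierStokesRegularity.FunctionalMining

end
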